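import Literature.Computability.Complexity.FlatRuns
import HarnessLib

/-!
# Normal form of standard `TM2` machines: the stack alphabet recoded by a permutation

Companion of `PolyTimeCountable.lean` (every bundled machine `M : Turing.TM2ComputableAux Γ₀ Γ₁`
is simulated step for step by a *standard machine* `TM2Std.stdCode M.tm : TM2Std.SCode`, all
types `Fin _`, the stack symbols numbered by an ARBITRARY bijection `TM2Std.enc`) and of
`FlatRuns.lean` (the two-way flat simulation `FlatProg.flat_complete` / `FlatProg.flat_sound` of
the guarded standard machine `FlatProg.ucode M`), and an ingredient of the tree's clocked
universal machine (Arora–Barak 2009, §1.4.1 and Thm. 1.9: before simulating, "`𝒰` can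
transform a representation of every TM `M` into a representation of an equivalent TM `M̃`" of a
convenient shape, book p. 21 — there: alphabet `{▷, □, 0, 1}`). The surgery here is the
**recoding of the stack alphabet along a permutation `π` of `Fin (N + 1)`** (`push` pushes `π`
of the symbol, `peek`/`pop` undo `π` before consulting the transition table), so that a
universal machine may assume that the two INPUT symbols of a machine over `{0, 1}` carry the
codes `0` and `1` (`TM2Std.exists_perm_apply_eq_zero_one`, `FlatProg.exists_inputPerm`) — which
makes "write the coded input word" ONE string homomorphism, uniform in the machine.

Main results (`c : SCode`, `π : Equiv.Perm (Fin (c.N + 1))`, `c.perm π` the recoded machine,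
`TM2Std.permCfg c π : c.tm.Cfg → (c.perm π).tm.Cfg` the recoding of configurations):

* `TM2Std.stepAux_perm`, `TM2Std.step_perm`, `TM2Std.iterate_perm` — the recoded machine on
  recoded configurations IS the machine (an equation between runs, both ways, `π` being
  invertible); `TM2Std.permCfg_initList`, `TM2Std.permCfg_haltList`;
* for a bundled machine `M` and `FlatProg.pcode M π = (FlatProg.ucode M).perm π` (the recoded
  guarded standard machine), with flat initial / halting configurations `FlatProg.pinitCfg`,
  `FlatProg.phaltCfg` (spelled out in `pinitCfg_eq` / `phaltCfg_eq`): the two-way interface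
  **`FlatProg.pflat_complete`**: `M.OutputsWithin x y t → t · haltAddr ≤ m →
  (step (compile (pcode M π)))^[m] (pinitCfg M π x) = phaltCfg M π y` and
  **`FlatProg.pflat_sound`**: the converse with time bound `m` — `FlatRuns.lean` transported
  along `π`;
* `FlatProg.exists_inputPerm` — for a machine with input alphabet `Bool` there is a `π` under
  which the coded input word of `x` is `x` with `false ↦ 0`, `true ↦ 1`.

Mathlib has no relabelling of `TM2` alphabets (searched `Computability/TuringMachine/*`:
`Turing.TM0.Machine.map` is `TM0` only).

## References

* S. Arora, B. Barak, *Computational Complexity: A Modern Approach*, CUP 2009, §1.4 (machines as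
  strings), §1.4.1 and Thm. 1.9 (the universal machine first brings `M` into a normal form),
  Claim 1.5 (alphabet reduction as an equivalent-machine transformation) [AroraBarakCC2009].
* Mathlib `Mathlib/Computability/TuringMachine/StackTuringMachine.lean` (`Turing.TM2.stepAux`),
  `Mathlib/Computability/TuringMachine/Computable.lean` (`Turing.initList`, `Turing.haltList`).
-/

noncomputable section

namespace Literature.Computability.Complexity

open Turing StateTransition Function

namespace TM2Std

/-! ### A permutation sending two symbols to `0` and `1` -/

/-- Two distinct elements of `Fin (n + 1)` can be moved to (elements with values) `0` and `1` by
a permutation. [folklore] -/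
theorem exists_perm_apply_eq_zero_one {n : ℕ} {a b : Fin (n + 1)} (h : a ≠ b) :
    ∃ π : Equiv.Perm (Fin (n + 1)), (π a : ℕ) = 0 ∧ (π b : ℕ) = 1 := by
  rcases n with _ | n
  · exact absurd (Fin.ext (by have := a.isLt; have := b.isLt; omega)) h
  · have h10 : (1 : Fin (n + 2)) ≠ 0 := by simp
    have hb : Equiv.swap a 0 b ≠ 0 := by
      intro hb0
      have : Equiv.swap a 0 b = Equiv.swap a 0 a := by rw [hb0, Equiv.swap_apply_left]
      exact h ((Equiv.swap a 0).injective this).symm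
    refine ⟨(Equiv.swap a 0).trans (Equiv.swap (Equiv.swap a 0 b) 1), ?_, ?_⟩
    · rw [Equiv.trans_apply, Equiv.swap_apply_left, Equiv.swap_apply_of_ne_of_ne hb.symm h10.symm]
      rfl
    · rw [Equiv.trans_apply, Equiv.swap_apply_left, Fin.val_one]

/-! ### Recoded statements -/

section Stmt

variable {nK N nΛ nσ : ℕ}

/-- **The recoding of a statement** along a permutation `π` of the stack alphabet: pushed symbols
are recoded by `π`, read symbols decoded by `π⁻¹` before the transition tables are consulted.
[cite: AroraBarakCC2009, §1.4.1 and Claim 1.5 (recoding the alphabet of the simulated machine)] -/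
def SStmt.perm (π : Equiv.Perm (Fin (N + 1))) : SStmt nK N nΛ nσ → SStmt nK N nΛ nσ
  | .push k f q => .push k (fun s => π (f s)) (SStmt.perm π q)
  | .peek k f q => .peek k (fun s o => f s (o.map π.symm)) (SStmt.perm π q)
  | .pop k f q => .pop k (fun s o => f s (o.map π.symm)) (SStmt.perm π q)
  | .load f q => .load f (SStmt.perm π q)
  | .branch p q₁ q₂ => .branch p (SStmt.perm π q₁) (SStmt.perm π q₂)
  | .goto f => .goto f
  | .halt => .halt

/-- Recoding a stack assignment symbol by symbol. [folklore] -/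
def permStk (π : Equiv.Perm (Fin (N + 1))) (S : Fin nK → List (Fin (N + 1))) :
    Fin nK → List (Fin (N + 1)) :=
  fun k => (S k).map π

/-- Recoding a configuration: label and state kept, stacks recoded. [folklore] -/
def permCfgAux (π : Equiv.Perm (Fin (N + 1)))
    (a : TM2.Cfg (fun _ : Fin nK => Fin (N + 1)) (Fin nΛ) (Fin nσ)) :
    TM2.Cfg (fun _ : Fin nK => Fin (N + 1)) (Fin nΛ) (Fin nσ) :=
  ⟨a.l, a.var, permStk π a.stk⟩

/-- Recoding at an index. [folklore] -/
@[simp] theorem permStk_apply (π : Equiv.Perm (Fin (N + 1))) (S : Fin nK → List (Fin (N + 1)))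
    (k : Fin nK) : permStk π S k = (S k).map π := rfl

/-- Recoding commutes with writing a stack. [folklore] -/
theorem permStk_update (π : Equiv.Perm (Fin (N + 1))) (S : Fin nK → List (Fin (N + 1)))
    (k : Fin nK) (L : List (Fin (N + 1))) :
    permStk π (update S k L) = update (permStk π S) k (L.map π) := by
  funext k'
  by_cases h : k' = k
  · subst h
    simp [permStk]
  · simp [permStk, update_of_ne h]

/-- Recoding the empty stack assignment. [folklore] -/
@[simp] theorem permStk_empty (π : Equiv.Perm (Fin (N + 1))) :
    permStk π (fun _ : Fin nK => ([] : List (Fin (N + 1)))) = fun _ => [] := rfl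

/-- Recoding is injective. [folklore] -/
theorem permStk_injective (π : Equiv.Perm (Fin (N + 1))) :
    Injective (permStk (nK := nK) π) := by
  intro S S' h
  funext k
  exact (List.map_injective_iff.2 π.injective) (congrFun h k)

/-- Decoding the top of a recoded stack. [folklore] -/
theorem head?_permStk_map_symm (π : Equiv.Perm (Fin (N + 1))) (S : Fin nK → List (Fin (N + 1)))
    (k : Fin nK) : ((permStk π S k).head?).map π.symm = (S k).head? := by
  cases h : S k <;> simp [h]

/-- **Simulation of one statement**: executing the recoded statement on the recoded stacks gives
the recoded result. [cite: AroraBarakCC2009, §1.4.1] -/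
theorem stepAux_perm (π : Equiv.Perm (Fin (N + 1))) :
    ∀ (q : SStmt nK N nΛ nσ) (v : Fin nσ) (S : Fin nK → List (Fin (N + 1))),
      TM2.stepAux (SStmt.perm π q).toStmt v (permStk π S) =
        permCfgAux π (TM2.stepAux q.toStmt v S)
  | .push k f q, v, S => by
    simp only [SStmt.perm, SStmt.toStmt, TM2.stepAux]
    have h : update (permStk π S) k (π (f v) :: permStk π S k) =
        permStk π (update S k (f v :: S k)) := by
      rw [permStk_update, List.map_cons, permStk_apply]
    rw [h]
    exact stepAux_perm π q v _
  | .peek k f q, v, S => by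
    simp only [SStmt.perm, SStmt.toStmt, TM2.stepAux]
    rw [head?_permStk_map_symm]
    exact stepAux_perm π q _ S
  | .pop k f q, v, S => by
    simp only [SStmt.perm, SStmt.toStmt, TM2.stepAux]
    have h : update (permStk π S) k (permStk π S k).tail = permStk π (update S k (S k).tail) := by
      rw [permStk_update, List.map_tail, permStk_apply]
    rw [head?_permStk_map_symm, h]
    exact stepAux_perm π q _ _
  | .load f q, v, S => by
    simp only [SStmt.perm, SStmt.toStmt, TM2.stepAux]
    exact stepAux_perm π q _ S
  | .branch p q₁ q₂, v, S => by
    simp only [SStmt.perm, SStmt.toStmt, TM2.stepAux]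
    cases p v
    · exact stepAux_perm π q₂ v S
    · exact stepAux_perm π q₁ v S
  | .goto f, v, S => rfl
  | .halt, v, S => rfl

end Stmt

/-! ### The recoded machine of a standard machine -/

/-- **The recoded machine** `c.perm π`: the same sizes, stacks, labels and states, the program
recoded statement by statement. [cite: AroraBarakCC2009, §1.4.1 and Claim 1.5] -/
@[reducible] def SCode.perm (c : SCode) (π : Equiv.Perm (Fin (c.N + 1))) : SCode where
  nK := c.nK
  N := c.N
  nΛ := c.nΛ
  nσ := c.nσ
  k₀ := c.k₀
  k₁ := c.k₁
  main := c.main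
  init := c.init
  prog := fun l => SStmt.perm π (c.prog l)

variable (c : SCode) (π : Equiv.Perm (Fin (c.N + 1)))

/-- **The recoding of configurations** of `c` by configurations of `c.perm π`. [folklore] -/
def permCfg (a : c.tm.Cfg) : (c.perm π).tm.Cfg :=
  permCfgAux π a

/-- The stacks of a recoded configuration. [folklore] -/
@[simp] theorem permCfg_stk (a : c.tm.Cfg) : (permCfg c π a).stk = permStk π a.stk := rfl

/-- The label of a recoded configuration. [folklore] -/
@[simp] theorem permCfg_l (a : c.tm.Cfg) : (permCfg c π a).l = a.l := rfl

/-- The state of a recoded configuration. [folklore] -/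
@[simp] theorem permCfg_var (a : c.tm.Cfg) : (permCfg c π a).var = a.var := rfl

/-- Recoding configurations is injective. [folklore] -/
theorem permCfg_injective : Injective (permCfg c π) := by
  rintro ⟨l, v, S⟩ ⟨l', v', S'⟩ h
  have hl : l = l' := congrArg TM2.Cfg.l h
  have hv : v = v' := congrArg TM2.Cfg.var h
  have hS : permStk π S = permStk π S' := congrArg TM2.Cfg.stk h
  subst hl hv
  rw [permStk_injective π hS]

/-- **Simulation of one step** (an equation: the recoded machine does on recoded configurations
exactly what the machine does). [cite: AroraBarakCC2009, §1.4.1] -/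
theorem step_perm (a : c.tm.Cfg) :
    (c.perm π).tm.step (permCfg c π a) = (c.tm.step a).map (permCfg c π) := by
  obtain ⟨_ | l, v, S⟩ := a
  · rfl
  · change some (TM2.stepAux (SStmt.perm π (c.prog l)).toStmt v (permStk π S)) =
      some (permCfgAux π (TM2.stepAux (c.prog l).toStmt v S))
    rw [stepAux_perm]

/-- **Simulation of runs** (an equation). [cite: AroraBarakCC2009, §1.4.1] -/
theorem iterate_perm (n : ℕ) : ∀ a : c.tm.Cfg,
    (flip bind (c.perm π).tm.step)^[n] (some (permCfg c π a)) =
      ((flip bind c.tm.step)^[n] (some a)).map (permCfg c π) := by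
  induction n with
  | zero => intro a; rfl
  | succ n ih =>
    intro a
    rw [TM2Comp.iterate_bind_succ, TM2Comp.iterate_bind_succ, step_perm]
    cases c.tm.step a with
    | none => rw [Option.map_none, TM2Comp.iterate_bind_none, TM2Comp.iterate_bind_none, Option.map_none]
    | some a' => rw [Option.map_some]; exact ih a'

/-- Recoding the initial configuration: the initial configuration on the recoded input. [folklore] -/
theorem permCfg_initList (L : List (Fin (c.N + 1))) :
    permCfg c π (initList c.tm L) = initList (c.perm π).tm (L.map π) := by
  rw [TM2Comp.initList_eq, TM2Comp.initList_eq]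
  show (⟨some c.main, c.init, permStk π (update (fun _ => []) c.k₀ L)⟩ : (c.perm π).tm.Cfg) = _
  rw [permStk_update, permStk_empty]

/-- Recoding the halting configuration: the halting configuration on the recoded output. [folklore] -/
theorem permCfg_haltList (L : List (Fin (c.N + 1))) :
    permCfg c π (haltList c.tm L) = haltList (c.perm π).tm (L.map π) := by
  rw [TM2Comp.haltList_eq, TM2Comp.haltList_eq]
  show (⟨none, c.init, permStk π (update (fun _ => []) c.k₁ L)⟩ : (c.perm π).tm.Cfg) = _
  rw [permStk_update, permStk_empty]

end TM2Std

/-! ### Flat runs of the recoded guarded standard machine, both ways -/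

namespace FlatProg

open Turing TM2Std Function
open UnivTM2 (encStk)

variable {Γ₀ Γ₁ : Type} (M : TM2ComputableAux Γ₀ Γ₁) (π : Equiv.Perm (Fin ((ucode M).N + 1)))

/-- **The standard code simulated by the universal machine for `M`, alphabet recoded by `π`**:
the recoded standard machine of the halting guard of `M`. [cite: AroraBarakCC2009, §1.4.1] -/
abbrev pcode : SCode := (ucode M).perm π

/-- The flat initial configuration of `M` on `x` (input word recoded). [folklore] -/
def pinitCfg (x : List Γ₀) : Cfg :=
  trCfg (pcode M π) (initList (pcode M π).tm ((inCode M x).map π))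

/-- The flat halting configuration of `M` with output `y` (output word recoded). [folklore] -/
def phaltCfg (y : List Γ₁) : Cfg :=
  trCfg (pcode M π) (haltList (pcode M π).tm ((outCode M y).map π))

/-- The flat initial configuration, spelled out. [folklore] -/
theorem pinitCfg_eq (x : List Γ₀) :
    pinitCfg M π x = (entry (pcode M π) (pcode M π).main (pcode M π).init,
      (List.replicate (ucode M).nK []).set (ucode M).k₀ (((inCode M x).map π).map Fin.val)) := by
  rw [pinitCfg, TM2Comp.initList_eq]
  show (entry (pcode M π) (pcode M π).main (pcode M π).init, encStk _) = _
  rw [UnivTM2.encStk_update, UnivTM2.encStk_empty]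

/-- The flat halting configuration, spelled out. [folklore] -/
theorem phaltCfg_eq (y : List Γ₁) :
    phaltCfg M π y = (haltAddr (pcode M π),
      (List.replicate (ucode M).nK []).set (ucode M).k₁ (((outCode M y).map π).map Fin.val)) := by
  rw [phaltCfg, TM2Comp.haltList_eq]
  show (haltAddr (pcode M π), encStk _) = _
  rw [UnivTM2.encStk_update, UnivTM2.encStk_empty]

/-- The program counter of the flat halting configuration is the halt address. [folklore] -/
theorem phaltCfg_fst (y : List Γ₁) : (phaltCfg M π y).1 = haltAddr (pcode M π) :=
  trCfg_fst_of_none _ (by rw [TM2Comp.haltList_eq])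

/-- The guarded standard machine's halting run, recoded. [folklore] -/
theorem iterate_pcode_of_outputsWithin {x : List Γ₀} {y : List Γ₁} {t : ℕ} (h : M.OutputsWithin x y t) :
    ∃ n ≤ t, (flip bind (pcode M π).tm.step)^[n]
        (some (initList (pcode M π).tm ((inCode M x).map π))) =
      some (haltList (pcode M π).tm ((outCode M y).map π)) := by
  have hG : (HaltGuard.guardAux M).OutputsWithin x y t := (HaltGuard.outputsWithin_guardAux_iff M).2 h
  obtain ⟨⟨⟨n, hev⟩, hle⟩⟩ := (outputs_tr (HaltGuard.guardAux M).tm hG).1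
  simp only [Option.map_some] at hev
  refine ⟨n, hle, ?_⟩
  have := iterate_perm (ucode M) π n (initList (ucode M).tm (inCode M x))
  rw [permCfg_initList] at this
  rw [this]
  have hev' : (flip bind (ucode M).tm.step)^[n] (some (initList (ucode M).tm (inCode M x))) =
      some (haltList (ucode M).tm (outCode M y)) := hev
  rw [hev', Option.map_some, permCfg_haltList]

/-- **Completeness of the recoded flat simulation**: if `M` outputs `y` on `x` within `t` steps,
then for every `m ≥ t · haltAddr` the flat program of `pcode M π`, run `m` steps from the flat
initial configuration on `x`, sits at the flat halting configuration with output `y`.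
[cite: AroraBarakCC2009, §1.4.1 and Thm. 1.9] -/
theorem pflat_complete {x : List Γ₀} {y : List Γ₁} {t m : ℕ}
    (h : M.OutputsWithin x y t) (hm : t * haltAddr (pcode M π) ≤ m) :
    (step (compile (pcode M π)))^[m] (pinitCfg M π x) = phaltCfg M π y := by
  obtain ⟨n, hle, hev⟩ := iterate_pcode_of_outputsWithin M π h
  obtain ⟨m₀, hm₀, hrun⟩ := exists_iterate_le_of_iterate (pcode M π) n hev
  have hle' : m₀ ≤ m := hm₀.trans ((Nat.mul_le_mul_right _ hle).trans hm)
  obtain ⟨d, rfl⟩ := Nat.exists_eq_add_of_le hle'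
  rw [Nat.add_comm, iterate_add_apply]
  have hrun' : (step (compile (pcode M π)))^[m₀] (pinitCfg M π x) = phaltCfg M π y := hrun
  rw [hrun']
  exact iterate_step_of_le (by rw [length_compile, phaltCfg_fst]) d

/-- **Soundness of the recoded flat simulation**: if the flat program of `pcode M π`, run `m`
steps from the flat initial configuration on `x`, sits at the flat halting configuration with
output `y`, then `M` outputs `y` on `x` within `m` steps. [cite: AroraBarakCC2009, §1.4.1 and Thm. 1.9] -/
theorem pflat_sound {x : List Γ₀} {y : List Γ₁} {m : ℕ}
    (h : (step (compile (pcode M π)))^[m] (pinitCfg M π x) = phaltCfg M π y) :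
    M.OutputsWithin x y m := by
  have hpc : haltAddr (pcode M π) ≤ ((step (compile (pcode M π)))^[m] (pinitCfg M π x)).1 := by
    rw [h, phaltCfg_fst]
  obtain ⟨n, hn, d', hrun', hd', hfin⟩ := exists_halt_of_iterate (pcode M π) m _ hpc
  -- pull the run back along `π`
  have hback := iterate_perm (ucode M) π n (initList (ucode M).tm (inCode M x))
  rw [permCfg_initList] at hback
  have hrun'' : ((flip bind (ucode M).tm.step)^[n] (some (initList (ucode M).tm (inCode M x)))).map
      (permCfg (ucode M) π) = some d' := hback.symm.trans hrun'
  obtain ⟨d, hrun, rfl⟩ := Option.map_eq_some_iff.1 hrun''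
  have hd : (ucode M).tm.step d = none := by
    have := step_perm (ucode M) π d
    rw [hd'] at this
    cases hsd : (ucode M).tm.step d with
    | none => rfl
    | some _ => rw [hsd] at this; cases this
  -- `d` is the halting configuration of the guarded standard machine
  have hdl : d.l = none := (step_eq_none_iff _ d).1 hd
  have hdv : d.var = (ucode M).init :=
    std_var_of_halted (HaltGuard.guardAux M).tm (fun X Y => HaltGuard.guardAux_proper M) hrun hdl
  have hds : (haltList (ucode M).tm (outCode M y)).stk = d.stk := by
    have e := congrArg Prod.snd (h.symm.trans hfin)
    rw [phaltCfg, ← permCfg_haltList, trCfg_snd, trCfg_snd, permCfg_stk, permCfg_stk] at e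
    exact permStk_injective π (encStk_injective e)
  have hdeq : d = haltList (ucode M).tm (outCode M y) := by
    obtain ⟨dl, dv, ds⟩ := d
    simp only at hdl hdv hds
    subst hdl hdv
    rw [TM2Comp.haltList_eq] at hds ⊢
    simp only at hds
    rw [hds]
  subst hdeq
  have hstd : Nonempty (TM2OutputsInTime (ucode M).tm (inCode M x) (some (outCode M y)) m) :=
    ⟨⟨⟨n, by simpa using hrun⟩, hn⟩⟩
  exact (HaltGuard.outputsWithin_guardAux_iff M).1
    (outputsInTime_of_std (HaltGuard.guardAux M).tm hstd)

/-! ### Machines over `{0, 1}`: input symbols at codes `0` and `1` -/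

/-- **The input recoding**: for a machine with input alphabet `Bool` there is a permutation of
the codes under which the coded input word of `x` is `x` itself, `false ↦ 0`, `true ↦ 1`.
[cite: AroraBarakCC2009, §1.4.1 (the universal machine may assume a fixed alphabet)] -/
theorem exists_inputPerm {Γ₁ : Type} (M : TM2ComputableAux Bool Γ₁) :
    ∃ π : Equiv.Perm (Fin ((ucode M).N + 1)), ∀ x : List Bool,
      ((inCode M x).map π).map Fin.val = x.map fun b => if b then 1 else 0 := by
  set tm := (HaltGuard.guardAux M).tm
  have hne : enc tm ⟨tm.k₀, M.inputAlphabet.symm false⟩ ≠ enc tm ⟨tm.k₀, M.inputAlphabet.symm true⟩ := by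
    intro he
    have h1 := eq_of_enc_eq tm (Or.inl ⟨_, rfl⟩) he
    have h2 : M.inputAlphabet.symm false = M.inputAlphabet.symm true := eq_of_heq (Sigma.mk.inj h1).2
    exact Bool.false_ne_true (M.inputAlphabet.symm.injective h2)
  obtain ⟨π, h0, h1⟩ := exists_perm_apply_eq_zero_one hne
  refine ⟨π, fun x => ?_⟩
  simp only [inCode, stkCode, List.map_map]
  refine List.map_congr_left fun b _ => ?_
  cases b
  · exact h0
  · exact h1

end FlatProg

end Literature.Computability.Complexity
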